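import Literature.MathematicalPhysics.StatisticalMechanics.HardSphereContactTheoremProofs

/-!
# Uniform convergence of the insertion ratios of the canonical hard-sphere gas (all sub-densities)

Helper file for item `LocalGibbsConcentrationDilute` (stmt-AtomisticToContinuum-13460) of route
`JaynesSqueeze`, first part of the unconditional identification of the local-density
approximation: for the homogeneous canonical hard-sphere gas on `𝕋³` at small reduced density `σ`
(`N + 1` spheres of diameter `ε_N = σ (N+1)^{-1/3}`, uniform one-body law), the inverse insertion
probabilities `q_N(m) = Ξ_N(m)/Ξ_N(m+1)` converge UNIFORMLY IN `m ≤ N`: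
`sup_{m ≤ N} |q_N(m) - R(σ ((m+1)/(N+1))^{1/3})| → 0` (`qN_uniform`), where `R(σ')` is the limit
insertion ratio of `HardSphereEulerRatio` (`ratioLimit uniformProfile σ'`). The tree proves
`q_N(N - l) → R(σ)` for every fixed shift `l` (`SmallDensity.tendsto_qN_sub`); here the same
two-scale contraction is run over all `m` at once: the first `m + 1` labels of the level-`N` system
ARE the level-`m` system at reduced density `σ' = σ ((m+1)/(N+1))^{1/3}` (same diameter;
marginalisation `Xi_eq_Xi_self`, `Wd_eq_Wd_self`), the deterministic estimate
`SmallDensity.abs_inv_qN_sub_inv_le` of the tree applies at `(σ', m)`, the limit ratios are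
Lipschitz in `σ'³` (`abs_ratioLimit_sub_le`), the coefficients `C(m, j) W_N(j+1)` converge to
`((m+1)/(N+1))ʲ γ_j` uniformly in `m` (`coefN_uniform`), and a strong induction on `m` at fixed
`N` closes the contraction.

No definitions (pure-proof helper file). prover-pitem-stmt-AtomisticToContinuum-13460-0.
-/

noncomputable section

namespace Summit.AtomisticToContinuum.HydrodynamicLimit.Theorems

open MeasureTheory Filter Topology Set Finset
open Literature.Analysis.FluidPDE Literature.MathematicalPhysics.KineticTheory
open Literature.MathematicalPhysics.StatisticalMechanics Literature.Probability.LatticeModels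
open scoped ENNReal

namespace LocalGibbsConcentration

section Marginal

variable (P : DensityProfile) (ε : ℝ)

/-- Restricting a configuration to the first `k` labels transports the hard-core indicator of the
block `firstLabels n k` to that of all labels. [folklore] -/
theorem efR_firstLabels_eq {k n : ℕ} (h : k ≤ n) (x : Fin n → T3) :
    efR (Ov ε) x (firstLabels n k) = efR (Ov ε) (fun i : Fin k => x (Fin.castLE h i)) Finset.univ := by
  rw [efR_eq_indicator, efR_eq_indicator]
  have hiff : x ∈ hardCoreSet (Ov ε) (firstLabels n k) ↔
      (fun i : Fin k => x (Fin.castLE h i)) ∈ hardCoreSet (Ov ε) (Finset.univ : Finset (Fin k)) := by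
    simp only [hardCoreSet, Set.mem_setOf_eq, Finset.mem_univ, true_implies, mem_firstLabels]
    constructor
    · intro H i j hij
      exact H (Fin.castLE h i) i.isLt (Fin.castLE h j) j.isLt
        (fun heq => hij (Fin.castLE_injective h heq))
    · intro H i hi j hj hij
      have := H ⟨i, hi⟩ ⟨j, hj⟩ (fun heq => hij (by
        have := congrArg Fin.val heq; exact Fin.ext this))
      simpa using this
  by_cases hx : x ∈ hardCoreSet (Ov ε) (firstLabels n k)
  · rw [Set.indicator_of_mem hx, Set.indicator_of_mem (hiff.1 hx)]; rfl
  · rw [Set.indicator_of_notMem hx, Set.indicator_of_notMem (fun h' => hx (hiff.2 h'))]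

/-- **Marginalisation of the partition functions**: the hard-core probability of the first `k`
labels among `n ≥ k` iid points equals that of `k` points. [folklore] -/
theorem Xi_eq_Xi_self {k n : ℕ} (h : k ≤ n) : Xi P ε n k = Xi P ε k k := by
  rw [Xi, Xi, firstLabels_self, ← integral_efR P.μ (measurableSet_ov ε),
    ← integral_efR P.μ (measurableSet_ov ε)]
  have hF : Measurable fun y : Fin k → T3 => efR (Ov ε) y Finset.univ :=
    measurable_efR (measurableSet_ov ε) _
  rw [← integral_pi_comp_castLE P h hF]
  exact integral_congr_ae (ae_of_all _ fun x => efR_firstLabels_eq ε h x)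

variable {P ε}

/-- **The sub-system identity for `Ξ`**: if the level-`m` system at `σ'` has the same diameter as
the level-`N` system at `σ` (`m ≤ N`), their partition functions of `k ≤ m + 1` labels agree.
[folklore] -/
theorem XiN_eq_of_hsDiameter_eq {σ σ' : ℝ} {N m : ℕ} (hmN : m ≤ N)
    (hε : hsDiameter σ' m = hsDiameter σ N) {k : ℕ} (hk : k ≤ m + 1) :
    XiN P σ' m k = XiN P σ N k := by
  rw [XiN, XiN, hε, Xi_eq_Xi_self P _ hk, Xi_eq_Xi_self P _ (show k ≤ N + 1 by omega)]

/-- The sub-system identity for the ratios `q`. [folklore] -/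
theorem qN_eq_of_hsDiameter_eq {σ σ' : ℝ} {N m : ℕ} (hmN : m ≤ N)
    (hε : hsDiameter σ' m = hsDiameter σ N) {k : ℕ} (hk : k ≤ m) :
    qN P σ' m k = qN P σ N k := by
  rw [qN, qN, XiN_eq_of_hsDiameter_eq hmN hε (by omega), XiN_eq_of_hsDiameter_eq hmN hε (by omega)]

/-- The sub-system identity for the ratio products `r`. [folklore] -/
theorem rN_eq_of_hsDiameter_eq {σ σ' : ℝ} {N m : ℕ} (hmN : m ≤ N)
    (hε : hsDiameter σ' m = hsDiameter σ N) {k j : ℕ} (hk : k ≤ m + 1) :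
    rN P σ' m k j = rN P σ N k j := by
  rw [rN, rN, XiN_eq_of_hsDiameter_eq hmN hε (by omega), XiN_eq_of_hsDiameter_eq hmN hε hk]

/-- The sub-system identity for the coefficients `C(k, j) W(j+1)` (`Wd_eq_Wd_self`). [folklore] -/
theorem coefN_eq_of_hsDiameter_eq {σ σ' : ℝ} {N m : ℕ} (hmN : m ≤ N)
    (hε : hsDiameter σ' m = hsDiameter σ N) {g : T3 → ℝ} (hg : Measurable g) {k j : ℕ}
    (hj : j ≤ m) : coefN P σ' m g k j = coefN P σ N g k j := by
  rw [coefN, coefN, hε]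
  haveI : NeZero (j + 1) := ⟨Nat.succ_ne_zero j⟩
  rw [Wd_eq_Wd_self P _ (show j + 1 ≤ m + 1 by omega) hg,
    Wd_eq_Wd_self P _ (show j + 1 ≤ N + 1 by omega) hg]

end Marginal

section Scaling

/-- The sub-density of the first `m + 1` labels: `σ' = σ ((m+1)/(N+1))^{1/3}` has
`σ'³ = σ³ (m+1)/(N+1)`. [folklore] -/
theorem subSigma_pow_three (σ : ℝ) (N m : ℕ) :
    (σ * (((m + 1 : ℕ) : ℝ) / ((N + 1 : ℕ) : ℝ)) ^ (1 / 3 : ℝ)) ^ 3 =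
      σ ^ 3 * (((m + 1 : ℕ) : ℝ) / ((N + 1 : ℕ) : ℝ)) := by
  have ht : (0 : ℝ) ≤ ((m + 1 : ℕ) : ℝ) / ((N + 1 : ℕ) : ℝ) := by positivity
  rw [mul_pow, rpow_third_pow_three ht]

/-- `σ' ≥ 0`. [folklore] -/
theorem subSigma_nonneg {σ : ℝ} (hσ : 0 ≤ σ) (N m : ℕ) :
    0 ≤ σ * (((m + 1 : ℕ) : ℝ) / ((N + 1 : ℕ) : ℝ)) ^ (1 / 3 : ℝ) :=
  mul_nonneg hσ (Real.rpow_nonneg (by positivity) _)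

/-- `σ' ≤ σ` for `m ≤ N`. [folklore] -/
theorem subSigma_le {σ : ℝ} (hσ : 0 ≤ σ) {N m : ℕ} (hmN : m ≤ N) :
    σ * (((m + 1 : ℕ) : ℝ) / ((N + 1 : ℕ) : ℝ)) ^ (1 / 3 : ℝ) ≤ σ := by
  refine mul_le_of_le_one_right hσ (Real.rpow_le_one (by positivity) ?_ (by norm_num))
  rw [div_le_one (by positivity)]
  exact_mod_cast Nat.succ_le_succ hmN

/-- `0 < σ'` for `σ > 0`. [folklore] -/
theorem subSigma_pos {σ : ℝ} (hσ : 0 < σ) (N m : ℕ) :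
    0 < σ * (((m + 1 : ℕ) : ℝ) / ((N + 1 : ℕ) : ℝ)) ^ (1 / 3 : ℝ) :=
  mul_pos hσ (Real.rpow_pos_of_pos (by positivity) _)

/-- **Same diameter**: the level-`m` system at `σ'` has the diameter `ε_N` of the level-`N`
system at `σ`. [folklore] -/
theorem hsDiameter_subSigma {σ : ℝ} (hσ : 0 ≤ σ) (N m : ℕ) :
    hsDiameter (σ * (((m + 1 : ℕ) : ℝ) / ((N + 1 : ℕ) : ℝ)) ^ (1 / 3 : ℝ)) m = hsDiameter σ N := by
  have h1 : 0 ≤ hsDiameter (σ * (((m + 1 : ℕ) : ℝ) / ((N + 1 : ℕ) : ℝ)) ^ (1 / 3 : ℝ)) m :=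
    (hsDiameter_pos_or_nonneg (subSigma_nonneg hσ N m) m)
  have h2 : 0 ≤ hsDiameter σ N := hsDiameter_pos_or_nonneg hσ N
  refine (pow_left_inj₀ h1 h2 (by norm_num : (3 : ℕ) ≠ 0)).1 ?_
  rw [hsDiameter_pow_three, hsDiameter_pow_three, subSigma_pow_three σ]
  have hm : ((m + 1 : ℕ) : ℝ) ≠ 0 := by positivity
  have hN : ((N + 1 : ℕ) : ℝ) ≠ 0 := by positivity
  field_simp
where
  /-- `0 ≤ ε` (auxiliary). [folklore] -/
  hsDiameter_pos_or_nonneg {s : ℝ} (hs : 0 ≤ s) (n : ℕ) : 0 ≤ hsDiameter s n := by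
    unfold hsDiameter; positivity

/-- **Scaling of the cluster coefficients**: `γ_j(σ') = ((m+1)/(N+1))ʲ γ_j(σ)`. [folklore] -/
theorem clusterCoeff_subSigma (σ : ℝ) (N m j : ℕ) :
    clusterCoeff (σ * (((m + 1 : ℕ) : ℝ) / ((N + 1 : ℕ) : ℝ)) ^ (1 / 3 : ℝ)) j =
      (((m + 1 : ℕ) : ℝ) / ((N + 1 : ℕ) : ℝ)) ^ j * clusterCoeff σ j := by
  rw [clusterCoeff, clusterCoeff, subSigma_pow_three σ, mul_pow]
  ring

/-- The limit coefficients of the uniform profile at the sub-density: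
`coefLim 1 σ' 1 j = ((m+1)/(N+1))ʲ γ_j(σ)`. [folklore] -/
theorem coefLim_uniform_subSigma (σ : ℝ) (N m j : ℕ) :
    coefLim uniformProfile (σ * (((m + 1 : ℕ) : ℝ) / ((N + 1 : ℕ) : ℝ)) ^ (1 / 3 : ℝ)) (fun _ => 1) j =
      (((m + 1 : ℕ) : ℝ) / ((N + 1 : ℕ) : ℝ)) ^ j * clusterCoeff σ j := by
  rw [coefLim_uniform, clusterCoeff_subSigma σ]

end Scaling

section SmallDensityMono

/-- `κ = eθ/(1-θ)²` is monotone in `θ ∈ [0, 1)`. [folklore] -/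
theorem contraction_mono {θ θ' : ℝ} (h0 : 0 ≤ θ) (h : θ ≤ θ') (h1 : θ' < 1) :
    Real.exp 1 * θ / (1 - θ) ^ 2 ≤ Real.exp 1 * θ' / (1 - θ') ^ 2 := by
  have he := Real.exp_pos 1
  have hd : 0 < (1 - θ') ^ 2 := by nlinarith
  have hd' : 0 < (1 - θ) ^ 2 := by nlinarith
  rw [div_le_div_iff₀ hd' hd]
  have hmn : 0 ≤ θ * (θ' - θ) := mul_nonneg h0 (sub_nonneg.2 h)
  have : θ * (1 - θ') ^ 2 ≤ θ' * (1 - θ) ^ 2 := by nlinarith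
  nlinarith

/-- `eθ/(1-θ)` is monotone in `θ ∈ [0, 1)`. [folklore] -/
theorem phi_mono {θ θ' : ℝ} (h0 : 0 ≤ θ) (h : θ ≤ θ') (h1 : θ' < 1) :
    Real.exp 1 * θ / (1 - θ) ≤ Real.exp 1 * θ' / (1 - θ') := by
  have he := Real.exp_pos 1
  have hmn : 0 ≤ θ * (θ' - θ) := mul_nonneg h0 (sub_nonneg.2 h)
  rw [div_le_div_iff₀ (by linarith) (by linarith)]
  nlinarith

/-- **The smallness conditions are monotone in the density** (uniform profile): they pass from
`σ` to every `0 < σ' ≤ σ`. [folklore] -/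
theorem smallDensity_uniform_mono {σ σ' : ℝ} (h : SmallDensity uniformProfile σ) (h0 : 0 < σ')
    (hle : σ' ≤ σ) : SmallDensity uniformProfile σ' := by
  have hθ := geomRatio_uniform_mono h0.le hle
  have hθ0 : 0 ≤ geomRatio uniformProfile σ' := geomRatio_nonneg h0.le
  have hθ1 := h.geomRatio_lt_one
  refine ⟨h0, hle.trans_lt h.σ_lt_half, ?_, hθ.trans_lt hθ1, ?_, ?_⟩
  · have := h.ovDensity_le_half
    rw [ovDensity_uniformProfile] at this ⊢
    have hv := v₁_pos
    have : σ' ^ 3 ≤ σ ^ 3 := pow_le_pow_left₀ h0.le hle 3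
    nlinarith
  · exact (phi_mono hθ0 hθ hθ1).trans_lt h.phi_lt_half
  · have := h.four_contractionC_lt_one
    rw [contractionC] at this ⊢
    linarith [contraction_mono hθ0 hθ hθ1]

/-- `geomTail` is monotone in the density. [folklore] -/
theorem geomTail_uniform_mono {σ σ' : ℝ} (h : SmallDensity uniformProfile σ) (h0 : 0 < σ')
    (hle : σ' ≤ σ) (J : ℕ) : geomTail uniformProfile σ' J ≤ geomTail uniformProfile σ J := by
  have hθ := geomRatio_uniform_mono h0.le hle
  have hθ0 : 0 ≤ geomRatio uniformProfile σ' := geomRatio_nonneg h0.le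
  have hθ1 := h.geomRatio_lt_one
  rw [geomTail, geomTail]
  have he := Real.exp_pos 1
  rw [div_le_div_iff₀ (by linarith) (by linarith)]
  have hp : geomRatio uniformProfile σ' ^ (J + 1) ≤ geomRatio uniformProfile σ ^ (J + 1) :=
    pow_le_pow_left₀ hθ0 hθ _
  have hp0 : 0 ≤ geomRatio uniformProfile σ' ^ (J + 1) := pow_nonneg hθ0 _
  nlinarith [mul_nonneg hp0 (sub_nonneg.2 hθ), mul_le_mul_of_nonneg_left hp he.le]

/-- `contractionC` is monotone in the density. [folklore] -/
theorem contractionC_uniform_mono {σ σ' : ℝ} (h : SmallDensity uniformProfile σ) (h0 : 0 < σ')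
    (hle : σ' ≤ σ) : contractionC uniformProfile σ' ≤ contractionC uniformProfile σ := by
  rw [contractionC, contractionC]
  exact contraction_mono (geomRatio_nonneg h0.le) (geomRatio_uniform_mono h0.le hle) h.geomRatio_lt_one

end SmallDensityMono

section RatioBounds

/-- **The limit ratio is close to `1` at low density**: `|R(σ') - 1| ≤ 2eθ'/(1-θ')`,
`θ' = geomRatio 1 σ'`. [folklore] -/
theorem abs_ratioLimit_sub_one_le {σ' : ℝ} (h : SmallDensity uniformProfile σ') :
    |ratioLimit uniformProfile σ' - 1| ≤
      2 * (Real.exp 1 * geomRatio uniformProfile σ' / (1 - geomRatio uniformProfile σ')) := by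
  set R := ratioLimit uniformProfile σ' with hR
  have hspec := ratioLimit_spec (P := uniformProfile) h.σ_pos h.σ_lt_half h.geomRatio_lt_one h.phi_lt_half
  have hRm : R ∈ Set.Icc (1 / 2 : ℝ) 2 := hspec.1
  have hF := abs_ratioSeries_sub_one_le (P := uniformProfile) h.σ_pos h.σ_lt_half h.geomRatio_lt_one
    (R := R) (abs_le.2 ⟨by linarith [hRm.1], hRm.2⟩)
  -- `R - 1 = R (1 - F(R))` since `R F(R) = 1`
  have hkey : R - 1 = R * (1 - ratioSeries uniformProfile σ' R) := by
    have := hspec.2; rw [mul_sub, mul_one, this]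
  rw [hkey, abs_mul, abs_of_nonneg (by linarith [hRm.1]), abs_sub_comm]
  exact mul_le_mul hRm.2 hF (abs_nonneg _) (by norm_num)

/-- The geometric ratio of the sub-density: `θ(σ') = ((m+1)/(N+1)) θ(σ)`. [folklore] -/
theorem geomRatio_subSigma (σ : ℝ) (N m : ℕ) :
    geomRatio uniformProfile (σ * (((m + 1 : ℕ) : ℝ) / ((N + 1 : ℕ) : ℝ)) ^ (1 / 3 : ℝ)) =
      (((m + 1 : ℕ) : ℝ) / ((N + 1 : ℕ) : ℝ)) * geomRatio uniformProfile σ := by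
  rw [geomRatio_uniform, geomRatio_uniform, subSigma_pow_three σ]
  ring

/-- **The limit ratio at the sub-density is within `(m+1)/(N+1)` of `1`**:
`|R(σ') - 1| ≤ (m+1)/(N+1)` (using `eθ/(1-θ) < 1/2` at `σ`). [folklore] -/
theorem abs_ratioLimit_subSigma_sub_one_le {σ : ℝ} (h : SmallDensity uniformProfile σ) {N m : ℕ}
    (hmN : m ≤ N) :
    |ratioLimit uniformProfile (σ * (((m + 1 : ℕ) : ℝ) / ((N + 1 : ℕ) : ℝ)) ^ (1 / 3 : ℝ)) - 1| ≤
      ((m + 1 : ℕ) : ℝ) / ((N + 1 : ℕ) : ℝ) := by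
  set t : ℝ := ((m + 1 : ℕ) : ℝ) / ((N + 1 : ℕ) : ℝ) with ht
  have ht0 : 0 ≤ t := by positivity
  have ht1 : t ≤ 1 := by
    rw [ht, div_le_one (by positivity)]; exact_mod_cast Nat.succ_le_succ hmN
  have h' := smallDensity_uniform_mono h (subSigma_pos h.σ_pos N m) (subSigma_le h.σ_pos.le hmN)
  refine (abs_ratioLimit_sub_one_le h').trans ?_
  rw [geomRatio_subSigma σ]
  set θ := geomRatio uniformProfile σ with hθ
  have hθ0 : 0 ≤ θ := geomRatio_nonneg h.σ_pos.le
  have hθ1 := h.geomRatio_lt_one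
  have hφ := h.phi_lt_half
  have hden : 1 - θ ≤ 1 - t * θ := by nlinarith
  have hden0 : 0 < 1 - θ := by linarith
  have hnum : 0 ≤ Real.exp 1 * (t * θ) := mul_nonneg (Real.exp_pos 1).le (mul_nonneg ht0 hθ0)
  calc 2 * (Real.exp 1 * (t * θ) / (1 - t * θ)) ≤ 2 * (Real.exp 1 * (t * θ) / (1 - θ)) := by
        refine mul_le_mul_of_nonneg_left ?_ (by norm_num)
        exact div_le_div_of_nonneg_left hnum hden0 hden
    _ = t * (2 * (Real.exp 1 * θ / (1 - θ))) := by ring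
    _ ≤ t * 1 := mul_le_mul_of_nonneg_left (by linarith) ht0
    _ = t := mul_one t

/-- **The finite ratios are within `(m+1)/(N+1)` of `1`**: `0 ≤ q_N(m) - 1 ≤ 2 m λ/(N+1) ≤ (m+1)/(N+1)`
(insertion bound `Ξ(m+1) ≥ Ξ(m)(1 - m p_ε)`, `λ ≤ 1/2`). [folklore] -/
theorem abs_qN_sub_one_le {σ : ℝ} (h : SmallDensity uniformProfile σ) {N m : ℕ} (hmN : m ≤ N) :
    |qN uniformProfile σ N m - 1| ≤ ((m + 1 : ℕ) : ℝ) / ((N + 1 : ℕ) : ℝ) := by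
  have hσ := h.σ_pos.le
  have hσ2 := h.σ_lt_half
  have hlam1 := h.ovDensity_lt_one
  have hlam2 := h.ovDensity_le_half
  have hq1 := one_le_qN (P := uniformProfile) hσ hσ2 hlam1 hmN
  rw [abs_of_nonneg (by linarith)]
  -- insertion bound
  have hXi := Xi_succ_ge (P := uniformProfile) (n := N + 1) (ε := hsDiameter σ N)
    (hsDiameter_nonneg' hσ N) (hsDiameter_lt_half hσ hσ2 N) (m := m) (by omega)
  have hp : (m : ℝ) * pOv uniformProfile (hsDiameter σ N) ≤ (m : ℝ) * (ovDensity uniformProfile σ / (N + 1 : ℕ)) := by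
    rw [pOv_hsDiameter]
  set p : ℝ := (m : ℝ) * pOv uniformProfile (hsDiameter σ N) with hp_def
  have hp_le : p ≤ (m : ℝ) / ((N + 1 : ℕ) : ℝ) * (1 / 2) := by
    calc p ≤ (m : ℝ) * (ovDensity uniformProfile σ / (N + 1 : ℕ)) := hp
      _ = (m : ℝ) / ((N + 1 : ℕ) : ℝ) * ovDensity uniformProfile σ := by ring
      _ ≤ (m : ℝ) / ((N + 1 : ℕ) : ℝ) * (1 / 2) := by gcongr
  have hmN' : (m : ℝ) / ((N + 1 : ℕ) : ℝ) ≤ 1 := by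
    rw [div_le_one (by positivity)]; exact_mod_cast (by omega : m ≤ N + 1)
  have hp_half : p ≤ 1 / 2 := by nlinarith [div_nonneg (Nat.cast_nonneg m) (by positivity : (0:ℝ) ≤ ((N + 1 : ℕ) : ℝ))]
  have hXipos := XiN_pos (P := uniformProfile) hσ hσ2 hlam1 (N := N) (m := m + 1) (by omega)
  have hXipos' := XiN_pos (P := uniformProfile) hσ hσ2 hlam1 (N := N) (m := m) (by omega)
  -- `q ≤ 1/(1 - p)`
  have hq : qN uniformProfile σ N m ≤ (1 - p)⁻¹ := by
    rw [qN, div_le_iff₀ hXipos, ← div_eq_inv_mul, le_div_iff₀ (by linarith)]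
    exact hXi
  have hp0 : 0 ≤ p := mul_nonneg (Nat.cast_nonneg m) (pOv_nonneg _ (hsDiameter_nonneg' hσ N))
  have h1p : 0 < 1 - p := by linarith
  have hprod : 1 ≤ (1 - p) * (1 + 2 * p) := by nlinarith
  have hinv : (1 - p)⁻¹ ≤ 1 + 2 * p := by
    calc (1 - p)⁻¹ = (1 - p)⁻¹ * 1 := (mul_one _).symm
      _ ≤ (1 - p)⁻¹ * ((1 - p) * (1 + 2 * p)) := mul_le_mul_of_nonneg_left hprod (inv_nonneg.2 h1p.le)
      _ = 1 + 2 * p := by field_simp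
  calc qN uniformProfile σ N m - 1 ≤ 2 * p := by linarith
    _ ≤ (m : ℝ) / ((N + 1 : ℕ) : ℝ) := by linarith
    _ ≤ ((m + 1 : ℕ) : ℝ) / ((N + 1 : ℕ) : ℝ) := by
        gcongr; exact_mod_cast Nat.le_succ m

end RatioBounds


end LocalGibbsConcentration

end Summit.AtomisticToContinuum.HydrodynamicLimit.Theorems
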